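import Mathlib.Data.Complex.Basic
import Mathlib.Data.Real.Basic
import Mathlib.Logic.Function.Iterate
import Mathlib.Tactic.Linarith
import Mathlib.Tactic.LinearCombination
import Mathlib.Tactic.IntervalCases
import HarnessLib

/-!
# [IUTchIII] Remark 3.12.2 (iii)–(v) with Fig. 3.9, Remark 3.12.3, Remark 3.12.4 with Fig. 3.10 (c312 crew, wave 2, III)

S. Mochizuki, *Inter-universal Teichmüller theory III*, author's kurims manuscript (May 2020) of PRIMS
**57** (2021), §3: Remark 3.12.2 (iii) p. 191 l. 34–46, (iv) p. 191 l. 47 – p. 192 l. 45, (v) p. 192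
l. 46 – p. 195 l. 5 with Fig. 3.9 p. 193; Remark 3.12.3 (i) p. 195 l. 7–36, (ii) p. 195 l. 37–47;
Remark 3.12.4 (i) p. 196 l. 6, (ii) l. 14, (iii) l. 29, (iv) l. 49 – p. 197 l. 10, (v) p. 198 l. 2–32,
(vi) p. 198 l. 33 with Fig. 3.10 p. 197 (PRIMS offset ≈ +420…+424) — READ ON THE PAGE by this seat
(abc-iut-c312-8, 2026-08-25; `paper:url-4b091feeb646`). Siblings: `Cor312Remarks.lean` (Rmk 3.12.1, 3.12.2
(i)), `Cor312RemarksToy.lean` (Rmk 3.12.2 (ii)); the bindings of (v) and of Rmk 3.12.4 (iii) to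
abc-iut-L6-t4's `holomorphicHull`/`IsHullSet`/`processionNormalized` (p404101/p404053, not yet built on the
farm at the time of writing) go to `Cor312Remarks3.lean`. Record-only typing of a DISPUTED text (D-0012 claim
key `Mochizuki2012`): every declaration quotes the sentence it types; nothing here takes a side on Corollary
3.12; "typed" ≠ "discharged"; `structure`s of `Prop` SLOTS are marked SLOT-ONLY and not counted as content.

* Rmk 3.12.2 (iii): `juggling_arch` ("multiplication by `±i`" is an almost complex structure — PROVED); the
  (Ind3) attribution is a quoted pointer (Prop. 3.5 (ii), L6-t4; c312-1's `Ind3`).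
* Rmk 3.12.2 (iv) [cited by Step (xi-a); c312-2's `Locus.rem3_12_2_iv`]: SLOT-ONLY `ColumnSimilarities` +
  the kernel `LogColumn.vol_iterate` (log-link compatibility ⟹ log-volumes ignore logarithmic conjugates).
* Rmk 3.12.2 (v) [cited by (xi-a), (xi-c), (xi-d); `Locus.rem3_12_2_v`]: Fig. 3.9 as a finite table (`fig39`,
  `fig39_upper_similar`, `fig39_lower_differ`), the kernels `LogColumn.vol_iterate` ("absorbed by passing to
  log-volumes") and `LogColumn.upperBound_zero` ("only … upper bounds" vs "precise equalities"), SLOT-ONLY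
  `ColumnDifferences` for the interpretive claims (the hull-absorption kernel is in `Cor312Remarks3.lean`).
* Rmk 3.12.3 (i): `eulerChar`, `IsHyperbolicType`, `eulerChar_neg_iff`, `chi_neg_of_gaussBonnet` (Gauss–Bonnet
  and positivity as HYPOTHESES ⟹ `χ_S < 0`); (ii): `noted`, SLOT-ONLY `TeichmuellerAnalogy`.
* Rmk 3.12.4 (i)–(iv), (vi): Fig. 3.10 as `Fig310Row`/`Fig310Row.subItem`/`fig310_census`; (v): the Hasse
  degree inequality `(1 − p)(2g_X − 2) ≤ 0` — `degree_ineq_of_inclusion`, `hasse_degree_ineq`,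
  `hasse_degree_ineq_strict_iff` (strict iff `g_X ≥ 2`, "a statement of the hyperbolicity"), all PROVED.
-/

namespace Summit.ABC.IUTFork.Cor312Rmk

/-! ## Remark 3.12.2 (iii): "juggling of ⊞, ⊠" -/

/-- **IUTchIII:Rmk3.12.2(iii)** (kurims p. 191 l. 34–46): "One fundamental aspect of the theory that renders
possible the «reassembling procedure» discussed in (ii) [cf. the discussion of Step (iv) of the proof of
Corollary 3.12] is the «juggling of ⊞, ⊠» [cf. the discussion of Remark 1.2.2, (vi)] effected by the log-links,
i.e., the vertical arrows of the log-theta-lattice. This «juggling of ⊞, ⊠» may be thought of as a sort of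
combinatorial way of representing the arithmetic holomorphic structure associated to a vertical line of the
log-theta-lattice. Indeed, at archimedean primes, this juggling amounts essentially to multiplication by `±i`,
which is a well-known method [cf. the notion of an «almost complex structure»!] for representing holomorphic
structures in the classical theory of differential manifolds. On the other hand, it is important to recall
in this context that this «juggling of ⊞, ⊠» is precisely what gives rise to the upper semi-compatibility
indeterminacy (Ind3) [cf. Proposition 3.5, (ii); Remark 3.10.1, (i)]." The archimedean kernel — multiplication
by `±i` is an almost complex structure (`J ∘ J = −1`) on `ℂ` — PROVED; the (Ind3) attribution is a pointer to
[IUTchIII] Prop. 3.5 (ii) (abc-iut-L6-t4) and c312-1's `Thm311.Ind3`, quoted only.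
[cite: Mochizuki2012, III Rmk 3.12.2 (iii) p.191] -/
theorem juggling_arch (z : ℂ) :
    Complex.I * (Complex.I * z) = -z ∧ (-Complex.I) * ((-Complex.I) * z) = -z := by
  constructor <;> linear_combination z * Complex.I_sq

/-! ## Remark 3.12.2 (iv): similarities between the 0- and 1-columns -/

/-- **IUTchIII:Rmk3.12.2(iv)** (kurims p. 191 l. 47 – p. 192 l. 45) — CITED by Step (xi-a) of the proof of Cor.
3.12 (p. 181 l. 37: "a q-pilot object at (1,0), which we think of … in terms of the holomorphic log-shells
constructed at (1,0) [cf. the discussion of Remark 3.12.2, (iv), (v), below]"). SLOT-ONLY structure (three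
`Prop` slots, instantiable by `True`, NOT counted as typed content): the printed similarities between "the
theory of log-Kummer correspondences in the 0- and 1-columns" (the upper half of Fig. 3.9), one quoted claim
per field; the vertical column is "depicted [«horizontally»!] in the fashion of the diagram of the third
display of Proposition 1.3, (iv)" (`•0 ∥ … → • → • → • → … ↘↓↙ ◦`, p. 192 l. 2–9; abc-iut-L6-t3's Prop. 1.3).
The one similarity with an elementary kernel (log-link compatibility ⟹ log-volumes do not see the choice
of logarithmic conjugate) is PROVED below as `LogColumn.vol_iterate`.
[cite: Mochizuki2012, III Rmk 3.12.2 (iv) p.192] -/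
structure ColumnSimilarities where
  /-- p. 192 l. 10–31: "since the Θ^{×μ}_{LGP}-link is fundamentally incompatible with the distinct arithmetic
  holomorphic structures — i.e., ring structures — that exist in the 0- and 1-columns, one is obliged to
  work with the Frobenius-like versions of the unit group and value group portions of monoids arising from
  «•0» in the definition of the Θ^{×μ}_{LGP}-link … one is also obliged to work with the étale-like «◦»
  versions of various objects since it is precisely these vertically coric versions that allow one to
  access, i.e., by serving as containers [cf. the discussion of (ii)] for, the other «•'s» in the vertical
  column … both «•0» and «◦» play an essential and by no means superfluous role in the theory of the
  vertical columns of the log-theta-lattice. This aspect of the theory is essentially the same in the case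
  of both the 0- and the 1-columns." -/
  essentialRoleOfBoth : Prop
  /-- p. 192 l. 33–36: "The log-link compatibility of the various log-volumes that appear [cf. the discussion
  of Step (x) of the proof of Corollary 3.12; Proposition 3.9, (iv); the final portion of Theorem 3.11,
  (ii)] is another aspect of the theory that is essentially the same in the case of both the 0- and the
  1-columns." (Prop. 3.9 (iv) = abc-iut-L6-t4's `Literature.IUT.LogThetaLattice.Prop39iv_b`.) -/
  logLinkCompatibilityBoth : Prop
  /-- p. 192 l. 36–44: "although the discussion of the «non-interference» properties that underlie the
  log-Kummer correspondences of Theorem 3.11, (ii), (b), (c), was only given expicitly, in effect, in the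
  case of the 0-column, i.e., concerning Θ-pilot objects, entirely similar «non-interference» properties
  hold for q-pilot objects. [Indeed, this may be seen, for instance, by applying the same arguments as the
  arguments that were applied in the case of Θ-pilot objects, or, for instance, by specializing the
  non-interference properties obtained for Θ-pilot objects to the index «`j = 1`» as in the discussion of
  «pivotal distributions» in [IUTchI], Example 5.4, (vii).]" -/
  nonInterferenceForQPilots : Prop

/-- The elementary kernel shared by Rmk 3.12.2 (iv) (p. 192 l. 33–36, "log-link compatibility of the various
log-volumes … essentially the same in … both the 0- and the 1-columns") and (v) (p. 194 l. 36–44, "the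
indeterminacy in the specification of a particular member of the collection of ring structures … — i.e.,
arising from the choice of a particular composite of arrows in the log-Kummer correspondence that is used
to specify a particular ring structure among its various «logarithmic conjugates» — is absorbed by passing
to log-volumes — i.e., by applying the log-link compatibility [cf. (iv)] of the various log-volumes
associated to these ring structures"): one vertical column, abstractly — regions `R`, the map `lg` induced
by one log-link on regions, a log-volume `vol`, and the log-link compatibility `vol ∘ lg = vol` ([IUTchIII]
Prop. 1.2 (iii) / Prop. 3.9 (iv), on the regions where it holds). Hypothesis data.
[cite: Mochizuki2012, III Rmk 3.12.2 (v) p.194] -/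
structure LogColumn where
  /-- regions in the log-shells of one vertical column -/
  Region : Type
  /-- the map on regions induced by one log-link `• → •` -/
  lg : Region → Region
  /-- a log-volume on regions -/
  vol : Region → ℝ
  /-- log-link compatibility of the log-volume ([IUTchIII] Prop. 3.9 (iv) (b)): `vol (lg S) = vol S` -/
  compat : ∀ S, vol (lg S) = vol S

namespace LogColumn

variable (C : LogColumn)

/-- Rmk 3.12.2 (v), p. 194 l. 41–44: the choice "of a particular composite of arrows in the log-Kummer
correspondence" — here: how many log-links one composes — "is absorbed by passing to log-volumes — i.e., by
applying the log-link compatibility": the log-volume of the `n`-fold logarithmic conjugate of a region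
equals that of the region, for every `n`. PROVED (induction on `n`).
[cite: Mochizuki2012, III Rmk 3.12.2 (v) p.194] -/
theorem vol_iterate (n : ℕ) (S : C.Region) : C.vol (C.lg^[n] S) = C.vol S := by
  induction n with
  | zero => rfl
  | succ n ih => rw [Function.iterate_succ_apply', C.compat, ih]

/-- Rmk 3.12.2 (v), p. 194 l. 44 – p. 195 l. 4: "unlike the case of the 0-column, where the mono-analytic
interpretation via regions of mono-analytic log-shells gives rise only to upper bounds on log-volumes, the
approach just discussed in the case of the 1-column … gives rise to precise equalities [i.e., not just
inequalities!] concerning log-volumes." The 0-column half, typed: for a MONOTONE log-volume and a region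
`U` contained in its container/hull `H`, one gets only `vol U ≤ vol H`. PROVED (the 1-column half is
`vol_iterate`). [cite: Mochizuki2012, III Rmk 3.12.2 (v) p.194] -/
theorem upperBound_zero {X : Type} (vol : Set X → ℝ) (mono : ∀ ⦃A B : Set X⦄, A ⊆ B → vol A ≤ vol B)
    {U H : Set X} (hUH : U ⊆ H) : vol U ≤ vol H :=
  mono hUH

end LogColumn

/-! ## Remark 3.12.2 (v): differences between the 0- and 1-columns; Fig. 3.9 -/

/-- The six "Aspect[s] of the theory" (row headers) of **Fig. 3.9** "Similarities and differences, in the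
context of the Θ^{×μ}_{LGP}-link, between the 0- and 1-columns of the log-theta-lattice" (kurims p. 193).
[cite: Mochizuki2012, III Fig 3.9 p.193] -/
inductive Fig39Aspect
  /-- "essential role of both «•0» and «◦»" -/
  | essentialRole
  /-- "log-link compatibility of log-volumes" -/
  | logLinkCompatibility
  /-- "«non-interference» properties of log-Kummer correspondences" -/
  | nonInterference
  /-- "multiradiality properties of Θ-[slash]q-pilot objects" (the printed row header has a slash right after the hyphen, which a Lean doc comment cannot contain) -/
  | multiradiality
  /-- "treatment of mono-analytic log-shells/unit group portions" -/
  | logShellTreatment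
  /-- "resulting indeterminacies" -/
  | indeterminacies
  deriving DecidableEq

/-- The entries of Fig. 3.9 (p. 193), columns "0-column/Θ-pilot objects" and "1-column/q-pilot objects".
[cite: Mochizuki2012, III Fig 3.9 p.193] -/
inductive Fig39Entry
  /-- "similar" -/
  | similar
  /-- "hold" -/
  | hold
  /-- "do not hold" -/
  | doNotHold
  /-- "used as containers for regions" -/
  | containersForRegions
  /-- "tautological documenting device for logarithmic relationship betw. ring structures" -/
  | documentingDevice
  /-- "(Ind1), (Ind2), (Ind3) acting on log-shells" -/
  | indeterminaciesOnLogShells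
  /-- "absorbed by applying holomorphic hulls, log-volumes" -/
  | absorbedByHullsAndLogVolumes
  deriving DecidableEq

/-- **Fig. 3.9** (kurims p. 193) as a function: aspect ↦ (0-column entry, 1-column entry), copied from the
printed table. [cite: Mochizuki2012, III Fig 3.9 p.193] -/
def fig39 : Fig39Aspect → Fig39Entry × Fig39Entry
  | .essentialRole => (.similar, .similar)
  | .logLinkCompatibility => (.similar, .similar)
  | .nonInterference => (.similar, .similar)
  | .multiradiality => (.hold, .doNotHold)
  | .logShellTreatment => (.containersForRegions, .documentingDevice)
  | .indeterminacies => (.indeterminaciesOnLogShells, .absorbedByHullsAndLogVolumes)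

/-- Rmk 3.12.2 (iv), last sentence (p. 192 l. 44–45): "These similarities between the 0- and 1-columns are
summarized in the upper portion of Fig. 3.9" — the first three rows carry "similar/similar". PROVED
(`decide`). [cite: Mochizuki2012, III Rmk 3.12.2 (iv) p.192] -/
theorem fig39_upper_similar :
    ∀ a ∈ [Fig39Aspect.essentialRole, .logLinkCompatibility, .nonInterference],
      fig39 a = (.similar, .similar) := by decide

/-- Rmk 3.12.2 (v) (p. 193 l. 2–5, p. 195 l. 4–5): "one significant difference … is the lack of analogues for
q-pilot objects of the crucial multiradiality properties summarized in Theorem 3.11, (iii), (c)"; "These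
differences between the 0- and 1-columns are summarized in the lower portion of Fig. 3.9" — the last three
rows have distinct entries in the two columns. PROVED (`decide`). [cite: Mochizuki2012, III Rmk 3.12.2 (v) p.193] -/
theorem fig39_lower_differ :
    ∀ a ∈ [Fig39Aspect.multiradiality, .logShellTreatment, .indeterminacies], (fig39 a).1 ≠ (fig39 a).2 := by
  decide

/-- **IUTchIII:Rmk3.12.2(v)** (kurims p. 192 l. 46 – p. 195 l. 5) — CITED by Steps (xi-a) (p. 181 l. 37), (xi-c)
(p. 182 l. 43) and (xi-d) (p. 183 l. 32, 37) of the proof of Cor. 3.12 (c312-2's `Locus.rem3_12_2_v`).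
SLOT-ONLY structure (instantiable by `True`, NOT counted as typed content) for the interpretive claims; the
two claims with an elementary kernel are REAL: "absorbed by passing to log-volumes" = `LogColumn.vol_iterate`
(above), "holomorphic hulls … have the effect of absorbing this indeterminacy [with respect to
«`𝒪^×`»-multiples]" = `Cor312Remarks3.lean` over abc-iut-L6-t4's `IsHullSet`/`holomorphicHull`; Fig. 3.9 is
`fig39`. [cite: Mochizuki2012, III Rmk 3.12.2 (v) p.194] -/
structure ColumnDifferences where
  /-- p. 193 l. 2–5, l. 30–31: "the lack of analogues for q-pilot objects of the crucial multiradiality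
  properties summarized in Theorem 3.11, (iii), (c) … i.e., in effect, the lack of an analogue for the
  q-pilot objects of the theory of rigidity properties developed in [EtTh] [cf. the discussion of Remark
  2.2.2, (i)]" -/
  noMultiradialityForQPilots : Prop
  /-- p. 194 l. 5–13 (0-column): the vertically coric holomorphic log-shells [Prop. 1.2 (ix)] "are used as
  containers … for the various regions … arising from these unit group portions via various composites of
  arrows in the log-Kummer correspondence … an interpretation … that makes sense even relative to the
  distinct arithmetic holomorphic structures that appear in the 1-column … it has the drawback that it gives
  rise to the upper semi-compatibility indeterminacy (Ind3)" -/
  zeroColumnContainers : Prop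
  /-- p. 194 l. 14–23 (1-column): "since the associated arithmetic holomorphic structure is held fixed and
  regarded [cf. … Step (xi) of the proof of Corollary 3.12] as the standard with respect to which
  constructions arising from the 0-column are to be computed, there is no need … to require that the
  constructions applied admit mono-analytic interpretations … the various unit group portions of monoids at
  the various «•'s» simply serve as a means of documenting the «logarithmic» relationship … between the ring
  structures in the domain and codomain of the log-link." -/
  oneColumnDocumenting : Prop
  /-- p. 194 l. 24–32: "These ring structures give rise to the local copies of sets of integral elements
  «𝒪» with respect to which the «𝔪𝔬𝔡» versions [cf. Example 3.6, (ii)] of categories of arithmetic line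
  bundles are defined at the various «•'s». Since the objects of these categories of arithmetic line
  bundles are not equipped with local trivializations at the various `v ∈ 𝕍` [cf. … Remark 3.6.2, (i)],
  regions in log-shells may only be related to such categories of arithmetic line bundles at the expense
  of allowing for an indeterminacy with respect to «`𝒪^×`»-multiples at each `v ∈ 𝕍`. It is precisely this
  indeterminacy that necessitates the introduction, in Step (xi) of the proof of Corollary 3.12, of
  holomorphic hulls, i.e., which have the effect of absorbing this indeterminacy [cf. the discussion of
  Remark 3.9.5, (vii), (viii), (ix), (x), for more details]." (Kernel: `Cor312Remarks3.lean`.) -/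
  unitMultipleIndeterminacyAbsorbedByHulls : Prop
  /-- p. 194 l. 44 – p. 195 l. 4: 0-column "gives rise only to upper bounds on log-volumes", 1-column "— i.e.,
  which makes essential use of the ring structures that are available as a consequence of the fact that the
  arithmetic holomorphic structure is held fixed — gives rise to precise equalities [i.e., not just
  inequalities!] concerning log-volumes" (kernels: `LogColumn.upperBound_zero`, `LogColumn.vol_iterate`). -/
  upperBoundsVersusEqualities : Prop

/-! ## Remark 3.12.3: the analogy with hyperbolic Riemann surfaces -/

/-- **IUTchIII:Rmk3.12.3(i)**, notation (kurims p. 195 l. 7–10): "Let `S` be a hyperbolic Riemann surface of finite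
type of genus `g_S` with `r_S` punctures. Write `χ_S := −(2g_S − 2 + r_S)` for the Euler characteristic of `S`".
[cite: Mochizuki2012, III Rmk 3.12.3 (i) p.195] -/
def eulerChar (g r : ℕ) : ℤ := -(2 * (g : ℤ) - 2 + r)

/-- "hyperbolic … of finite type" (p. 195 l. 7): the type `(g_S, r_S)` is hyperbolic iff `2g_S − 2 + r_S > 0`
(standard; the text takes `S` hyperbolic). [folklore] -/
def IsHyperbolicType (g r : ℕ) : Prop := 0 < 2 * (g : ℤ) - 2 + r

/-- Rmk 3.12.3 (i), p. 195 l. 15–20: "the inequality obtained in Corollary 3.12 may be regarded as corresponding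
to the inequality `χ_S = −∫_S dμ_S < 0` — i.e., in essence, a statement of the hyperbolicity of `S`": indeed
`χ_S < 0 ⟺ (g_S, r_S)` is hyperbolic. PROVED. [cite: Mochizuki2012, III Rmk 3.12.3 (i) p.195] -/
theorem eulerChar_neg_iff (g r : ℕ) : eulerChar g r < 0 ↔ IsHyperbolicType g r := by
  unfold eulerChar IsHyperbolicType; constructor <;> intro h <;> linarith

/-- Rmk 3.12.3 (i), p. 195 l. 16–21, the Gauss–Bonnet reading: "the inequality `χ_S = −∫_S dμ_S < 0` … arising from
the classical Gauss-Bonnet formula, together with the positivity of `dμ_S`" (`dμ_S` = "the Kähler metric on `S`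
[i.e., the (1,1)-form] determined by the Poincaré metric on the upper half-plane", l. 10–12). Typed with
Gauss–Bonnet (`χ_S = −∫_S dμ_S`, in the author's normalisation) and positivity (`∫_S dμ_S > 0`) as HYPOTHESES on
two real numbers: then `χ_S < 0`. PROVED; neither hypothesis is asserted here. The further analogy chain of
(i) (l. 21–36: real analytic Kähler metrics ↔ ordinary Frobenius liftings [pOrd]; positivity of `dμ_S` ↔ the
Kodaira–Spencer isomorphism of an indigenous bundle; ↔ "the «maximal incompatibility» between the various
Kummer isomorphisms and the corically constructed data of the Frobenius-picture of Proposition 1.2, (x)"; ↔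
"the upper semi-compatibility indeterminacy (Ind3) of Theorem 3.11, (ii), that underlies the inequality of
Corollary 3.12 [cf. Step (x) of the proof of Corollary 3.12]") is interpretive and only quoted.
[cite: Mochizuki2012, III Rmk 3.12.3 (i) p.195] -/
theorem chi_neg_of_gaussBonnet {χ area : ℝ} (gaussBonnet : χ = -area) (positivity : 0 < area) : χ < 0 := by
  rw [gaussBonnet]; linarith

/-- **IUTchIII:Rmk3.12.3(ii)** (kurims p. 195 l. 37–47) — `noted`, SLOT-ONLY (one `Prop` slot, instantiable by
`True`, NOT counted as typed content): "The «metric aspect» of Corollary 3.12 discussed in (i) is reminiscent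
of the analogy between the theory of the present series of papers and classical complex Teichmüller theory
[cf. the discussion of [IUTchI], Remark 3.9.3] in the following sense: Just as classical complex Teichmüller
theory is concerned with relating distinct holomorphic structures in a sufficiently canonical way as to
minimize the resulting conformality distortion, the canonical nature of the algorithms discussed in Theorem
3.11 for relating alien arithmetic holomorphic structures [cf. Remark 3.11.1] gives rise to a relatively
strong estimate of the [log-]volume distortion [cf. Corollary 3.12] resulting from such a deformation of the
arithmetic holomorphic structure." [cite: Mochizuki2012, III Rmk 3.12.3 (ii) p.195] -/
structure TeichmuellerAnalogy where
  /-- the quoted analogy, as an uninterpreted slot -/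
  volumeDistortionEstimate : Prop

/-! ## Remark 3.12.4: the analogy with `p`-adic Teichmüller theory; Fig. 3.10 -/

/-- **IUTchIII:Rmk3.12.4(vi)** with **(i)–(iv)**: "The analogies of the above discussion are summarized in Fig. 3.10"
(p. 198 l. 33) — **Fig. 3.10** "The analogy between inter-universal Teichmüller theory and `p`-adic Teichmüller
theory" (kurims p. 197), one constructor per printed row (left column ↦ right column), each docstring naming
the sub-item of Remark 3.12.4 (pp. 196–198) that states it. Expository content: the rows ARE the typed form
of sub-items (i), (ii), (iii), (iv); (iii)'s sentence "This «absolute comparison» is precisely what results in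
the indeterminacies (Ind1), (Ind2) of Theorem 3.11, (i)" (p. 196 l. 46–48) and (iv)'s "natural isomorphism to
the «absolute moduli» … the «moduli over `𝔽_1`»" (p. 197 l. 6–7) are quoted, not typed.
[cite: Mochizuki2012, III Rmk 3.12.4 (vi) p.198] -/
inductive Fig310Row
  /-- (i) p. 196 l. 6–9: "splitting monoids at `v ∈ 𝕍^bad` [cf. Theorem 3.11, (i), (b); Theorem 3.11, (ii), (b)]"
  ↦ "canonical coordinates on the ordinary locus" ("of `p`-adic Teichmüller theory [cf., e.g., [pTeich],
  Introduction, §0.9] that are constructed over the ordinary locus of a canonical curve") -/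
  | splittingMonoids
  /-- (i) p. 196 l. 9–11: "bad primes `∈ 𝕍^bad`" ↦ "ordinary locus of a can. curve" -/
  | badPrimes
  /-- (i) p. 196 l. 11–12: "good primes `∈ 𝕍^good`" ↦ "supersing. locus of a can. curve" -/
  | goodPrimes
  /-- (ii) p. 196 l. 14–18: "mono-analytic log-shells «`𝒪^{×μ}`»" ("the bi-coric mono-analytic log-shells …
  that appear in the tensor packets of Theorem 3.11, (i), (a); Theorem 3.11, (ii), (a)") ↦ "[multiplicative!]
  Teich. reps." ("Teichmüller representatives associated to the various Witt rings") -/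
  | monoAnalyticLogShells
  /-- (ii) p. 196 l. 18–28: "uniradial «local hol. units `𝒪^×`» subject to `𝔽_l^{⋊±}`-symmetry" ↦ "pos. char. ring
  structures on [pos. char. reductions of] Teich. reps." ("the uniradial, i.e., «non-multiradial», nature of
  these «local holomorphic units» … may be regarded as corresponding to the mixed characteristic nature of
  Witt rings, i.e., the incompatibility of Teichmüller representatives with the additive structure") -/
  | localHolomorphicUnits
  /-- (iii) p. 196 l. 29–39: "set of «theta value labels» `𝔽_l^⋇`" ↦ "factor `p` in mod `p/p²` portion of Witt
  vectors" ("one may think of the procession-normalized volumes obtained by taking averages over `j ∈ 𝔽_l^⋇`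
  [cf. Corollary 3.12] as corresponding to the operation of dividing by `p`") -/
  | thetaValueLabels
  /-- (iii) p. 196 l. 39–48: "multiradial rep. via `𝔽_l^⋇`-labeled mono-analytic log-shells [cf. (Ind1), (Ind2),
  (Ind3)]" ↦ "derivative of the canonical Frobenius lifting" -/
  | multiradialRepresentation
  /-- (iv) p. 196 l. 49 – p. 197 l. 10: "set of «theta value labels» `𝔽_l^⋇`" ↦ "implicit «absolute moduli/`𝔽_1`»"
  ("the set of labels `𝔽_l^⋇` may, alternatively, be thought of as corresponding to the infinitesimal moduli of
  the positive characteristic curve") -/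
  | absoluteModuli
  /-- (v) p. 198 l. 28–32: "inequality arising from upper semi-compatibility [cf. (Ind3)]" ↦ "inequality arising
  from interference between Frobenius conjugates" -/
  | inequality
  deriving DecidableEq

/-- Which sub-item (i)–(v) of Remark 3.12.4 states each row of Fig. 3.10 (as `1, …, 5`).
[cite: Mochizuki2012, III Rmk 3.12.4 (vi) p.198] -/
def Fig310Row.subItem : Fig310Row → ℕ
  | .splittingMonoids | .badPrimes | .goodPrimes => 1
  | .monoAnalyticLogShells | .localHolomorphicUnits => 2
  | .thetaValueLabels | .multiradialRepresentation => 3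
  | .absoluteModuli => 4
  | .inequality => 5

/-- All nine rows of Fig. 3.10, in printed order. [cite: Mochizuki2012, III Fig 3.10 p.197] -/
def Fig310Row.all : List Fig310Row := [.splittingMonoids, .badPrimes, .goodPrimes, .monoAnalyticLogShells,
  .localHolomorphicUnits, .thetaValueLabels, .multiradialRepresentation, .absoluteModuli, .inequality]

/-- Census of Fig. 3.10 / Rmk 3.12.4 (i)–(v): nine rows, every row listed, stated by sub-items (i) ×3, (ii) ×2,
(iii) ×2, (iv) ×1, (v) ×1. PROVED (`decide`). [folklore] -/
theorem fig310_census (r : Fig310Row) :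
    r ∈ Fig310Row.all ∧ Fig310Row.all.length = 9 ∧
      (Fig310Row.all.filter (·.subItem = 1)).length = 3 ∧ (Fig310Row.all.filter (·.subItem = 2)).length = 2 ∧
      (Fig310Row.all.filter (·.subItem = 3)).length = 2 ∧ (Fig310Row.all.filter (·.subItem = 4)).length = 1 ∧
      (Fig310Row.all.filter (·.subItem = 5)).length = 1 := by
  cases r <;> decide

/-- **IUTchIII:Rmk3.12.4(v)** (kurims p. 198 l. 2–23), the degree computation: for `X` a canonical smooth proper
hyperbolic curve of genus `g_X` over the Witt vectors `A = W(k)`, with canonical Frobenius lifting `Φ` on the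
ordinary locus, "this derivative only yields [upon dividing by `p`] an inclusion [i.e., not an isomorphism!]
of line bundles `ω_{X_k} ↪ Φ^*ω_{X_k}` — also known as the «[square] Hasse invariant» [cf. [pOrd], Chapter II,
Proposition 2.6 …]. Thus, at the level of global degrees of line bundles, we obtain an inequality [i.e., not
an equality!] `(1 − p)(2g_X − 2) ≤ 0`". The bookkeeping step typed: an inclusion of line bundles gives
`deg ω ≤ deg Φ^*ω`, and `deg Φ^*ω = p · deg ω` (degree-`p` Frobenius), whence `(1 − p) · deg ω ≤ 0`. PROVED
(the geometric inputs enter as the hypothesis `hincl`). [cite: Mochizuki2012, III Rmk 3.12.4 (v) p.198] -/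
theorem degree_ineq_of_inclusion (degOmega p : ℤ) (hincl : degOmega ≤ p * degOmega) :
    (1 - p) * degOmega ≤ 0 := by
  have h : (1 - p) * degOmega = degOmega - p * degOmega := by ring
  rw [h]; linarith

/-- Rmk 3.12.4 (v), the displayed inequality "`(1 − p)(2g_X − 2) ≤ 0`" (p. 198 l. 21) for `deg ω_{X_k} = 2g_X − 2`:
holds for every `p ≥ 1` and `g_X ≥ 1`. PROVED. [cite: Mochizuki2012, III Rmk 3.12.4 (v) p.198] -/
theorem hasse_degree_ineq (p g : ℕ) (hp : 1 ≤ p) (hg : 1 ≤ g) : (1 - (p : ℤ)) * (2 * g - 2) ≤ 0 := by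
  have hp' : (1 : ℤ) ≤ p := by exact_mod_cast hp
  have hg' : (1 : ℤ) ≤ g := by exact_mod_cast hg
  nlinarith

/-- Rmk 3.12.4 (v), p. 198 l. 22–23: "— which may be thought of as being, in essence, a statement of the
hyperbolicity of `X` [cf. the inequality of the display of Remark 3.12.3, (i)]": for a prime `p` (indeed any
`p ≥ 2`) the inequality is STRICT exactly when `g_X ≥ 2`, i.e. when the proper curve `X` is hyperbolic
(`IsHyperbolicType g_X 0`). PROVED. The closing analogy (l. 23–32: the "Frobenius conjugate dimension" `n` of
`t^{p^n}` ↔ the vertical dimension of the log-theta-lattice; the inequality ↔ "the upper semi-compatibility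
indeterminacy (Ind3) of Theorem 3.11, (ii) — that underlie the inequality of Corollary 3.12") is row
`Fig310Row.inequality`, quoted only. [cite: Mochizuki2012, III Rmk 3.12.4 (v) p.198] -/
theorem hasse_degree_ineq_strict_iff (p g : ℕ) (hp : 2 ≤ p) :
    (1 - (p : ℤ)) * (2 * g - 2) < 0 ↔ IsHyperbolicType g 0 := by
  have hp' : (2 : ℤ) ≤ p := by exact_mod_cast hp
  unfold IsHyperbolicType
  push_cast
  constructor
  · intro h
    by_contra hg
    have hg' : 2 * (g : ℤ) - 2 + ((0 : ℕ) : ℤ) ≤ 0 := not_lt.mp hg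
    nlinarith
  · intro h
    nlinarith

end Summit.ABC.IUTFork.Cor312Rmk
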